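import Mathlib
import Literature.Analysis.ODE.InverseSquareLadderPreimage
import HarnessLib

/-!
# Pre-images under the Darboux ladder of data vanishing beyond the base point

Analysis/ODE support file (everything proved). Refinement of
`Literature.Analysis.ODE.exists_ladder_preimage` (`InverseSquareLadderPreimage.lean`): if the datum
`w ∈ C^m` vanishes on the closed half-line `[a, ∞)` and the inverse rungs are based at `a`, then the
pre-image `u` (`ladder ι n u = w`, `u ∈ C^{m+n}`) vanishes on `[a, ∞)` as well
(`exists_ladder_preimage_vanishing`) — each rung `e^{kI}∫_a^x e^{−kI} w` integrates zero. Used for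
far-field Cauchy data cut off beyond `B`: the free profiles behind the exact inverse-square wave are
then constant beyond `B` (route PhotonSphereChannels, `FixedModeChannels`, far side,
stmt-FinalStateConjecture-10048). Folklore.
-/

noncomputable section

namespace Literature.Analysis.ODE

open Set Filter Topology intervalIntegral

variable {ι I : ℝ → ℝ}

/-- **Pre-image vanishing beyond the base point.** [folklore] -/
theorem exists_ladder_preimage_vanishing (hI : ContDiff ℝ (⊤ : ℕ∞) I)
    (hI' : ∀ x, HasDerivAt I (ι x) x) (a : ℝ) (n : ℕ) :
    ∀ {m : ℕ} {w : ℝ → ℝ}, ContDiff ℝ m w → (∀ x, a ≤ x → w x = 0) →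
      ∃ u : ℝ → ℝ, ContDiff ℝ ((m + n : ℕ) : ℕ∞) u ∧ ladder ι n u = w ∧ ∀ x, a ≤ x → u x = 0 := by
  induction n with
  | zero =>
    intro m w hw hw0
    exact ⟨w, by simpa using hw, rfl, hw0⟩
  | succ n ih =>
    intro m w hw hw0
    set k : ℕ := n + 1 with hk
    set v : ℝ → ℝ := fun x => Real.exp ((k : ℝ) * I x)
      * ∫ y in a..x, Real.exp (-((k : ℝ) * I y)) * w y with hv
    have hIk : ContDiff ℝ (m + 1) fun x => (k : ℝ) * I x :=
      contDiff_const.mul (by exact_mod_cast contDiff_infty.1 hI (m + 1))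
    have hvC : ContDiff ℝ (m + 1) v := contDiff_integratingFactor hIk hw a
    have hstep : ladderStep ι k v = w := ladderStep_integratingFactor hI' hw.continuous k a
    -- `v` vanishes on `[a, ∞)`
    have hv0 : ∀ x, a ≤ x → v x = 0 := by
      intro x hx
      have hint : (∫ y in a..x, Real.exp (-((k : ℝ) * I y)) * w y) = 0 := by
        refine intervalIntegral.integral_zero_ae (Filter.Eventually.of_forall fun y hy => ?_)
        rw [uIoc_of_le hx] at hy
        simp [hw0 y hy.1.le]
      simp only [hv, hint, mul_zero]
    have hvC' : ContDiff ℝ ((m + 1 : ℕ) : ℕ∞) v := by exact_mod_cast hvC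
    obtain ⟨u, huC, hlad, hu0⟩ := ih hvC' hv0
    refine ⟨u, ?_, ?_, hu0⟩
    · have : m + 1 + n = m + (n + 1) := by ring
      rw [← this]; exact huC
    · rw [ladder_succ, hlad, ← hk, hstep]

end Literature.Analysis.ODE
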